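import Mathlib.Analysis.SpecialFunctions.Pow.Real
import HarnessLib

/-!
# K1L_D `LagrangianRenormalisationStepDesign` (stmt-AnomalousDissipation-27980), `stub_D1_V0R` (ruling D27-1), brick T8d-(e), part 1: SCALAR
# TOOLS for repackaging the master rate function `Γ` into the clause bound `B` (helper; `--kind proof --supports stmt-AnomalousDissipation-27980 --as helper`)

Summits-side helper file of route `SolenoidalFractalHomogenisation` (prover seat `ad-k1l-cellLawV-w1` g7; 0 sorry, no defs, no named facts; pure
real arithmetic).
* `xi_le_nu_div_K`, `xi_le_xi'`, `xi'_le_one` — from the clause's resolution hypothesis `‖ℓ‖·⌈K/ν⌉₊ ≤ n`: `ξ = ‖ℓ‖/n ≤ ν/K`, `ξ ≤ ξ' ≤ 1`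
  (`ξ' = ‖ℓ‖⌈K/ν⌉₊/n`);
* `min_inv_le` — `min t (1/r) ≤ (q/r)·min 1 (r'·t)` for `0 < r ≤ q·r'`, `q ≥ 1`, `t ≥ 0` (moving Duhamel factors `min(t, 1/r_lo)` onto the clause's
  `min(1, rate·t)`);
* `min_inv_le_inv` — `min t (1/r) ≤ 1/r`.
NOT a proof of any registered stub, of K1L_D, or of anomalous dissipation; rung F-D1.A0 infrastructure.
-/

set_option linter.dupNamespace false

noncomputable section

namespace Summit.AnomalousDissipation.AnomalousDissipation.Theorems.SolenoidalFractalHomogenisation.LagrangianStep.Sideband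

/-- `ξ ≤ ν/K`: from `L·⌈K/ν⌉₊ ≤ n` (`L ≥ 0`, `K, ν, n > 0`), `L/n ≤ ν/K`. [folklore] -/
theorem xi_le_nu_div_K {L K ν : ℝ} {n : ℕ} (hL : 0 ≤ L) (hK : 0 < K) (hν : 0 < ν) (hn : 0 < (n : ℝ))
    (hres : L * (⌈K / ν⌉₊ : ℝ) ≤ n) : L / n ≤ ν / K := by
  have hceil : K / ν ≤ (⌈K / ν⌉₊ : ℝ) := Nat.le_ceil _
  have h1 : L * (K / ν) ≤ n := (mul_le_mul_of_nonneg_left hceil hL).trans hres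
  rw [div_le_div_iff₀ hn hK]
  have h2 : L * K ≤ n * ν := by
    have := mul_le_mul_of_nonneg_right h1 hν.le
    calc L * K = L * (K / ν) * ν := by field_simp
      _ ≤ n * ν := this
  linarith

/-- `ξ ≤ ξ'`: `L/n ≤ L·⌈K/ν⌉₊/n` when `⌈K/ν⌉₊ ≥ 1` (`K, ν > 0`). [folklore] -/
theorem xi_le_xi' {L K ν : ℝ} {n : ℕ} (hL : 0 ≤ L) (hK : 0 < K) (hν : 0 < ν) (hn : 0 < (n : ℝ)) :
    L / n ≤ L * (⌈K / ν⌉₊ : ℝ) / n := by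
  have h1 : (1 : ℝ) ≤ (⌈K / ν⌉₊ : ℝ) := by
    have : 0 < ⌈K / ν⌉₊ := Nat.ceil_pos.2 (div_pos hK hν)
    exact_mod_cast this
  exact div_le_div_of_nonneg_right (by nlinarith) hn.le

/-- `ξ' ≤ 1`: `L·⌈K/ν⌉₊/n ≤ 1` from the resolution hypothesis. [folklore] -/
theorem xi'_le_one {L K ν : ℝ} {n : ℕ} (hn : 0 < (n : ℝ)) (hres : L * (⌈K / ν⌉₊ : ℝ) ≤ n) : L * (⌈K / ν⌉₊ : ℝ) / n ≤ 1 := by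
  rwa [div_le_one hn]

/-- `min t (1/r) ≤ 1/r`. [folklore] -/
theorem min_inv_le_inv (t : ℝ) {r : ℝ} : min t (1 / r) ≤ 1 / r := min_le_right _ _

/-- **Moving a Duhamel factor onto the clause's saturation factor**: for `0 < r`, `r ≤ q·r'`, `1 ≤ q`, `0 ≤ t`:
`min t (1/r) ≤ (q/r)·min 1 (r'·t)`. [folklore] -/
theorem min_inv_le {t r r' q : ℝ} (ht : 0 ≤ t) (hr : 0 < r) (hq : 1 ≤ q) (hrr : r ≤ q * r') :
    min t (1 / r) ≤ q / r * min 1 (r' * t) := by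
  rcases le_or_gt 1 (r' * t) with h1 | h1
  · rw [min_eq_left h1, mul_one]
    calc min t (1 / r) ≤ 1 / r := min_le_right _ _
      _ ≤ q / r := div_le_div_of_nonneg_right hq hr.le
  · rw [min_eq_right h1.le]
    calc min t (1 / r) ≤ t := min_le_left _ _
      _ = (1 / r) * (r * t) := by field_simp
      _ ≤ (1 / r) * (q * r' * t) := by
          refine mul_le_mul_of_nonneg_left ?_ (by positivity)
          exact mul_le_mul_of_nonneg_right hrr ht
      _ = q / r * (r' * t) := by ring

/-- `min 1 (r·t) ≤ 1` and `0 ≤ min 1 (r·t)` for `r, t ≥ 0`. [folklore] -/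
theorem min_one_mul_nonneg {r t : ℝ} (hr : 0 ≤ r) (ht : 0 ≤ t) : 0 ≤ min 1 (r * t) := le_min zero_le_one (mul_nonneg hr ht)

end Summit.AnomalousDissipation.AnomalousDissipation.Theorems.SolenoidalFractalHomogenisation.LagrangianStep.Sideband

end
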